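import Mathlib.Analysis.SpecialFunctions.Pow.Real
import Mathlib.Analysis.SpecificLimits.Basic
import Literature.NumberTheory.Sieve.SmoothMajorantLocal
import HarnessLib

/-!
# Dimock's analyticity-radius bookkeeping `θ_k = ∏_{i<k} (1 - e_i^ε)` (QED₃ ultraviolet stability)

**Citation header (reproduction of PUBLISHED work; template of the Balaban lattice Yang–Mills cell).**
J. Dimock, *Ultraviolet stability for QED in d = 3*, Ann. Henri Poincaré **23** (2022) 2113–2205
(= arXiv:2009.01156v2) [Dimock2022UVStabilityQED3] — the third paper of Dimock's QED₃ series, whose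
inductive step follows "especially Balaban's work on Yang-Mills [Bal87], [Bal88a], [Bal88b]" (§3,
first paragraph).

**What is reproduced.** The one piece of REAL-NUMBER bookkeeping by which the analyticity domains
`𝓡_{k,𝛀}` of the main theorem (Def. 1: `|𝒜| ≤ L^{(k-j)/2} θ_k e_j^{-3/4+ε}`, …) are allowed to
shrink a little at every renormalization-group step and still stay uniformly large: with the running
coupling `e_k = L^{-(N-k)/2} e` (§2.1) and
`θ_k = ∏_{i=0}^{k-1} (1 - e_i^ε)`, the paper states (display before Def. 1): "Since
`Σ_{i=0}^{k-1} e_i^ε = 𝒪(e^ε)` we have for `e` small (depending on `ε`) that `½ ≤ θ_k ≤ 2` for all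
`k`", and uses the recursion `θ_{k+1} = (1 - e_k^ε) θ_k` in the scaling step of the proof of Thm 1
("Note that `E_{k+1}` is analytic in `𝒜 ∈ 𝓡̃_{k+1,𝛀⁺}` since then `𝒜_L ∈ (1-e_k^ε) 𝓡̃_{k,𝛀}`").
READING NOTE (recorded in the cell's TEMPLATE.md §1 C3): the arXiv source prints the factor inside the
product and the summand as `e_k^ε`; the recursion actually used, and the claim `Σ = 𝒪(e^ε)`
uniformly in `N`, require `e_i^ε` — which is what is typed here; the printed upper bound "`≤ 2`" is
vacuous (`θ_k ≤ 1`), and is typed as `≤ 1`.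

Everything below is PROVED (no named facts): the geometric bound
`Σ_{i<k} e_i^ε ≤ e^ε ρ^ε/(1-ρ^ε)` for `k ≤ N` (`ρ = L^{-1/2} ∈ (0,1)`), the bounds
`½ ≤ θ_k ≤ 1` under the explicit smallness condition `e^ε ρ^ε/(1-ρ^ε) ≤ ½`, the printed recursion,
and the existence of a threshold `e₀(ρ, ε) > 0` ("for `e` small depending on `ε`" — and on `L`).
The Weierstrass product inequality is REUSED from the tree
(`Literature.NumberTheory.Sieve.CFZ.one_sub_sum_le_prod_one_sub`), not re-declared.

**Why it is in the tree.** It is the template's written form of a step that Balaban's series states in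
prose only — CMP 119 (1988) p. 277: "The analyticity domains become smaller after each step, but the
difference is very small and exponentially decreasing in the number of steps" (cell file TEMPLATE.md
§14.2b row 11; GAPS agenda of the P14 sub-cell). The SHAPE transfers (a cumulative product of per-step
shrink factors is bounded below as soon as the per-step losses are summable); the SOURCE of
summability does not: here `e_i` is geometric because the model is superrenormalizable, whereas the
`d = 4` Yang–Mills coupling is marginal. Nothing in this file refers to or asserts anything about
Balaban's papers.
-/

noncomputable section

open Finset Real

namespace Literature.MathematicalPhysics.QuantumFieldTheory.Dimock2011to13

/-- The running coupling `e_k = L^{-(N-k)/2} e` of the QED₃ flow, written as `e · ρ^{N-k}` with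
`ρ = L^{-1/2}` (so `e_N = e`, `e_{k+1} = L^{1/2} e_k`).
[cite: Dimock2022UVStabilityQED3, §2.1 ("e_k = L^{-(N-k)/2} e", arXiv TeX l. 283–288)] -/
def runningCoupling (ρ e : ℝ) (N k : ℕ) : ℝ := e * ρ ^ (N - k)

/-- `θ_k = ∏_{i=0}^{k-1} (1 - e_i^ε)` — the cumulative shrink factor of the analyticity radii in
Def. 1 (`𝓡_{k,𝛀}`). [cite: Dimock2022UVStabilityQED3, §2.3 display before Def. 1 (arXiv TeX l. 572–575; printed with `e_k^ε`, read `e_i^ε`, see the module docstring)] -/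
def theta (ρ e ε : ℝ) (N k : ℕ) : ℝ :=
  ∏ i ∈ range k, (1 - (runningCoupling ρ e N i) ^ ε)

variable {ρ e ε : ℝ} {N k i : ℕ}

/-- `e_k ≥ 0`. [folklore] -/
theorem runningCoupling_nonneg (hρ : 0 ≤ ρ) (he : 0 ≤ e) (N k : ℕ) :
    0 ≤ runningCoupling ρ e N k :=
  mul_nonneg he (pow_nonneg hρ _)

/-- `e_k ≤ e` for `ρ ≤ 1` ("`e_k` … is small" as long as `e` is, §2.1). [folklore] -/
theorem runningCoupling_le (hρ0 : 0 ≤ ρ) (hρ1 : ρ ≤ 1) (he : 0 ≤ e) (N k : ℕ) :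
    runningCoupling ρ e N k ≤ e := by
  unfold runningCoupling
  exact mul_le_of_le_one_right he (pow_le_one₀ hρ0 hρ1)

/-- `e_N = e` (the coupling at the final, unit-lattice scale). [folklore] -/
@[simp] theorem runningCoupling_self (ρ e : ℝ) (N : ℕ) : runningCoupling ρ e N N = e := by
  simp [runningCoupling]

/-- `e_i^ε = e^ε (ρ^ε)^{N-i}`. [folklore] -/
theorem runningCoupling_rpow (hρ : 0 ≤ ρ) (he : 0 ≤ e) (ε : ℝ) (N i : ℕ) :
    (runningCoupling ρ e N i) ^ ε = e ^ ε * (ρ ^ ε) ^ (N - i) := by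
  unfold runningCoupling
  rw [Real.mul_rpow he (pow_nonneg hρ _), ← Real.rpow_pow_comm hρ]

/-- The printed recursion `θ_{k+1} = (1 - e_k^ε) θ_k` (used in the scaling step of the proof of
Thm 1). [cite: Dimock2022UVStabilityQED3, §3.15 ("θ_{k+1} = (1-e_k^ε) θ_k", arXiv TeX l. 4262)] -/
theorem theta_succ (ρ e ε : ℝ) (N k : ℕ) :
    theta ρ e ε N (k + 1) = (1 - (runningCoupling ρ e N k) ^ ε) * theta ρ e ε N k := by
  unfold theta
  rw [prod_range_succ, mul_comm]

/-- `θ_0 = 1`. [folklore] -/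
@[simp] theorem theta_zero (ρ e ε : ℝ) (N : ℕ) : theta ρ e ε N 0 = 1 := by
  simp [theta]

/-- The geometric bound behind "`Σ_{i=0}^{k-1} e_i^ε = 𝒪(e^ε)`": for `0 < ρ < 1`, `ε > 0` and
`k ≤ N`, `Σ_{i<k} e_i^ε ≤ e^ε · ρ^ε/(1-ρ^ε)` (uniformly in `N`).
[cite: Dimock2022UVStabilityQED3, §2.3 display before Def. 1 (arXiv TeX l. 575)] -/
theorem sum_rpow_runningCoupling_le (hρ0 : 0 < ρ) (hρ1 : ρ < 1) (he : 0 ≤ e) (hε : 0 < ε)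
    (hk : k ≤ N) :
    ∑ i ∈ range k, (runningCoupling ρ e N i) ^ ε ≤ e ^ ε * (ρ ^ ε / (1 - ρ ^ ε)) := by
  set q : ℝ := ρ ^ ε with hq
  have hq0 : 0 < q := Real.rpow_pos_of_pos hρ0 ε
  have hq1 : q < 1 := Real.rpow_lt_one hρ0.le hρ1 hε
  have heε : 0 ≤ e ^ ε := Real.rpow_nonneg he ε
  -- rewrite every summand as `e^ε q^{N-i}` and factor `q^{N-k+1}` out
  have hterm : ∀ i ∈ range k, (runningCoupling ρ e N i) ^ ε = e ^ ε * (q ^ (N - k + 1) * q ^ (k - 1 - i)) := by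
    intro i hi
    rw [mem_range] at hi
    rw [runningCoupling_rpow hρ0.le he, ← pow_add]
    congr 2
    omega
  rw [sum_congr rfl hterm, ← mul_sum, ← mul_sum]
  refine mul_le_mul_of_nonneg_left ?_ heε
  -- `Σ_{i<k} q^{k-1-i} = Σ_{j<k} q^j ≤ (1-q)⁻¹` and `q^{N-k+1} ≤ q`
  have hgeom : ∑ i ∈ range k, q ^ (k - 1 - i) ≤ (1 - q)⁻¹ := by
    rw [sum_range_reflect (fun j => q ^ j) k, ← tsum_geometric_of_lt_one hq0.le hq1]
    exact (summable_geometric_of_lt_one hq0.le hq1).sum_le_tsum (range k) (fun j _ => pow_nonneg hq0.le j)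
  have hpow : q ^ (N - k + 1) ≤ q := pow_le_of_le_one hq0.le hq1.le (by omega)
  calc q ^ (N - k + 1) * ∑ i ∈ range k, q ^ (k - 1 - i)
      ≤ q * (1 - q)⁻¹ := mul_le_mul hpow hgeom (sum_nonneg fun i _ => pow_nonneg hq0.le _) hq0.le
    _ = q / (1 - q) := by rw [div_eq_mul_inv]

/-- `θ_k ≤ 1` (the printed "`≤ 2`" is vacuous): each factor `1 - e_i^ε` lies in `[0,1]` as soon as
`e_i^ε ≤ 1`, which the smallness condition guarantees.
[cite: Dimock2022UVStabilityQED3, §2.3 ("½ ≤ θ_k ≤ 2 for all k", arXiv TeX l. 575)] -/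
theorem theta_le_one (hρ0 : 0 < ρ) (hρ1 : ρ < 1) (he : 0 ≤ e) (hε : 0 < ε) (hk : k ≤ N)
    (hsmall : e ^ ε * (ρ ^ ε / (1 - ρ ^ ε)) ≤ 1 / 2) : theta ρ e ε N k ≤ 1 := by
  have hsum := (sum_rpow_runningCoupling_le hρ0 hρ1 he hε hk).trans hsmall
  have hx0 : ∀ i ∈ range k, 0 ≤ (runningCoupling ρ e N i) ^ ε :=
    fun i _ => Real.rpow_nonneg (runningCoupling_nonneg hρ0.le he N i) ε
  have hx1 : ∀ i ∈ range k, (runningCoupling ρ e N i) ^ ε ≤ 1 := fun i hi =>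
    ((single_le_sum hx0 hi).trans hsum).trans (by norm_num)
  exact prod_le_one (fun i hi => sub_nonneg.2 (hx1 i hi)) fun i hi => sub_le_self _ (hx0 i hi)

/-- `½ ≤ θ_k` for all `k ≤ N`, under the explicit smallness condition `e^ε ρ^ε/(1-ρ^ε) ≤ ½`
("for `e` small (depending on `ε`)"; the dependence on `L` through `ρ = L^{-1/2}` is implicit in the
source). Proof: Weierstrass' inequality `∏(1-x_i) ≥ 1 - Σ x_i` (reused from the tree) and the
geometric bound. [cite: Dimock2022UVStabilityQED3, §2.3 ("½ ≤ θ_k", arXiv TeX l. 575)] -/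
theorem half_le_theta (hρ0 : 0 < ρ) (hρ1 : ρ < 1) (he : 0 ≤ e) (hε : 0 < ε) (hk : k ≤ N)
    (hsmall : e ^ ε * (ρ ^ ε / (1 - ρ ^ ε)) ≤ 1 / 2) : 1 / 2 ≤ theta ρ e ε N k := by
  have hsum := (sum_rpow_runningCoupling_le hρ0 hρ1 he hε hk).trans hsmall
  have hx0 : ∀ i ∈ range k, 0 ≤ (runningCoupling ρ e N i) ^ ε :=
    fun i _ => Real.rpow_nonneg (runningCoupling_nonneg hρ0.le he N i) ε
  have hx1 : ∀ i ∈ range k, (runningCoupling ρ e N i) ^ ε ≤ 1 := fun i hi =>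
    ((single_le_sum hx0 hi).trans hsum).trans (by norm_num)
  have hW := Literature.NumberTheory.Sieve.CFZ.one_sub_sum_le_prod_one_sub (range k) hx0 hx1
  unfold theta
  linarith

/-- **The printed statement, with its smallness condition made explicit** ("Since `Σ e_i^ε = 𝒪(e^ε)`
we have for `e` small (depending on `ε`) that `½ ≤ θ_k [≤ 1]` for all `k`"): for `0 < ρ < 1`
(`ρ = L^{-1/2}`, `L > 1`) and `ε > 0` there is `e₀ > 0` such that for every bare coupling
`0 ≤ e ≤ e₀`, every cutoff `N` and every `k ≤ N`, `½ ≤ θ_k ≤ 1`.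
[cite: Dimock2022UVStabilityQED3, §2.3 display before Def. 1 (arXiv TeX l. 572–575)] -/
theorem Dimock2022_theta_bounds (hρ0 : 0 < ρ) (hρ1 : ρ < 1) (hε : 0 < ε) :
    ∃ e₀ : ℝ, 0 < e₀ ∧ ∀ e : ℝ, 0 ≤ e → e ≤ e₀ → ∀ N k : ℕ, k ≤ N →
      1 / 2 ≤ theta ρ e ε N k ∧ theta ρ e ε N k ≤ 1 := by
  set q : ℝ := ρ ^ ε with hq
  have hq0 : 0 < q := Real.rpow_pos_of_pos hρ0 ε
  have hq1 : q < 1 := Real.rpow_lt_one hρ0.le hρ1 hε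
  -- the constant `c = q/(1-q) > 0`; choose `e₀` with `e₀^ε = 1/(2(c+1))`
  set c : ℝ := q / (1 - q) with hc
  have hc0 : 0 < c := div_pos hq0 (by linarith)
  set t : ℝ := 1 / (2 * (c + 1)) with ht
  have ht0 : 0 < t := by positivity
  refine ⟨t ^ (1 / ε), Real.rpow_pos_of_pos ht0 _, fun e he hle N k hk => ?_⟩
  have heε : e ^ ε ≤ t := by
    have h1 : e ^ ε ≤ (t ^ (1 / ε)) ^ ε := Real.rpow_le_rpow he hle hε.le
    rwa [← Real.rpow_mul ht0.le, one_div_mul_cancel hε.ne', Real.rpow_one] at h1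
  have hsmall : e ^ ε * (ρ ^ ε / (1 - ρ ^ ε)) ≤ 1 / 2 := by
    rw [← hq, ← hc]
    calc e ^ ε * c ≤ t * c := mul_le_mul_of_nonneg_right heε hc0.le
      _ = c / (2 * (c + 1)) := by rw [ht]; ring
      _ ≤ 1 / 2 := by
        rw [div_le_iff₀ (by positivity)]
        nlinarith
  exact ⟨half_le_theta hρ0 hρ1 he hε hk hsmall, theta_le_one hρ0 hρ1 he hε hk hsmall⟩

end Literature.MathematicalPhysics.QuantumFieldTheory.Dimock2011to13

end
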